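import Summits.SmoothPoincare4.SmoothPoincare4.Theses.CircularKirby
import Literature.Topology.FourManifolds.CircleMorse
import Literature.Topology.FourManifolds.CircleMorseProofs

/-!
# Birth skeleton — crux `RankTwo` (item `stmt-SmoothPoincare4-6423`), line `birth`

Route `route-SmoothPoincare4-CircularKirby` (circular Kirby calculus on `X_Σ = Σ # (S¹×S³)`, the Morse–Novikov
ladder `μ○ ≤ 4`), rank-2 crux `Summit.SmoothPoincare4.SmoothPoincare4.Theses.CircularKirby.RankTwo`:

> for every closed smooth `X ≃ₕ S¹×S³` containing a smoothly embedded non-separating `S³`: if `X` admits a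
> PRIMITIVE circle-valued Morse function (connected pull-back of `exp : ℝ → S¹`) with at most `4` critical
> points, then `X` admits a primitive circle-valued submersion (i.e. `X` fibres over `S¹`).

THE LINE is the route header's own reading of the crux (RUNG 2 of the `μ○`-ladder; TWO-LAYER PLAN "RankTwo ⇐
RankTwo022 → RankTwo121", NUMBERS "`χ(X_Σ) = 0`, so … μ○ is even; rung 1: indices `{2,3}`; rung 2: patterns
`(0,2,2), (1,2,1), (2,2,0)`"), typed over the Literature vocabulary that landed for this route
(`Literature/Topology/FourManifolds/CircleMorse.lean`: `IsCircleMorse`, `IsPrimitive`, `circleCriticalSet`,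
`circleMorseIndex` — each DEFINITIONALLY the crux's inline phrase: `IsCircleCriticalPt I f x := mfderiv I (𝓡 1) f x
= 0`, `circleHessian I f x := mhessian I (fun y => ((f y / f x : Circle) : ℂ).im) x`, `IsPrimitive f :=
IsConnected {p | f p.1 = Circle.exp p.2}`; the composition below bridges them by `rfl`). A primitive circle-valued
Morse function with `≤ 4` critical points is first put in NORMAL FORM (no local extrema, count not increased), then
the count is EVEN (`χ = 0`), hence `0`, `2` or `4`: count `≤ 2` is RUNG 1 (the route's crux `RankOne`, here only on
the class `𝒳` of the crux), count `= 4` without extrema is RUNG 2 proper — by `c₀ − c₁ + c₂ − c₃ + c₄ = χ = 0` its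
index pattern `(c₁, c₂, c₃)` is one of `(0,2,2)`, `(1,2,1)`, `(2,2,0)`, the three sectors named in the crux.

* `stub_noLocalExtrema` (a THEOREM; size L on paper, XL formal): a primitive circle-valued Morse map on a closed
  4-manifold can be replaced by a primitive circle-valued Morse map with no more critical points and none of index
  `0` or `4` (Pajitnov–Rudolph–Weber 2002, Lemma 3.2; Endo–Pajitnov 2017, Prop. 1.3 is the 2-knot-complement
  version, held text `paper:arxiv-1502.06352` chunk 3: "there is a regular Morse map g with m_i(g) ≤ m_i(f) for every
  i and m_0(g) = m_4(g) = 0"). Mechanism: in the connected infinite cyclic cover the lift `F` is unbounded below, so a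
  local minimum `p` is joined by exactly one gradient line to some index-1 point `q` leaving its basin; `(p, q)`
  cancel (Morse cancellation, Milnor 1965 Thm. 5.4), equivariantly; dually for index `4`.
* `stub_evenCriticalCount` (a THEOREM; size M on paper, L–XL formal): a circle-valued Morse map on a closed smooth
  4-manifold `X ≃ₕ S¹×S³` has an EVEN number of critical points: `Σ_k (−1)^k c_k(f) = χ(X)` (Poincaré–Hopf for a
  gradient-like vector field of `f`, Milnor TFDV §6 / Hirsch 1976 Ch. 6 §3; or the Morse–Novikov count, Farber 2004
  Prop. 1.40 / Pajitnov 2006) and `χ(X) = χ(S¹×S³) = 0` by homotopy invariance; in tree the cut-open form is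
  available: cut `X` at a regular level `Y` (closed 3-manifold, `χ(Y) = 0`) into a cobordism `(W; Y, Y)` and use
  `Cobordism.IsMorseFunction.morseCount_eq_zero_of_relEuler_eq` (CobordismMorseCountEuler.lean, PROVED).
* `stub_rungOne` (RUNG 1 restricted to the class `𝒳`; open, size L per the route): on `X ≃ₕ S¹×S³` with a
  non-separating `S³`, a primitive circle-valued Morse map with `≤ 2` critical points yields a fibration over `S¹`.
  It is the route's rank-3 crux `RankOne` (item stmt-SmoothPoincare4-6424, stated there for EVERY homotopy
  `S¹×S³`) SPECIALISED to `𝒳`, so it closes by one line the day `RankOne` lands, and it is not touched by the one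
  refutation scenario of `RankOne` the route header names (an exotic `S¹×S³` WITHOUT `S³` cross-section).
* `stub_rungTwoNoExtrema` (THE HEART, RUNG 2 proper; open-problem strength, SPC4-implied like the crux): on `X ∈ 𝒳`,
  a primitive circle-valued Morse map with EXACTLY `4` critical points, none of index `0` or `4`, yields a fibration
  over `S¹`. By the Euler count its pattern is `c₂ = 2`, `(c₁, c₃) ∈ {(0,2), (1,1), (2,0)}`; `(2,0)` is `(0,2)` for
  `f⁻¹ = conj ∘ f` (index `k ↔ 4 − k`), so the foreseen next split is exactly the header's `RankTwo022` /
  `RankTwo121`: over the level `S³` the sector `(0,2,2)` contains weak generalised Property 2R for 2-component links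
  with surgery `#²(S¹×S²)` (Gompf–Scharlemann–Thompson 2010 §9) and `(1,2,1)` the `(3;1,1,1)`-trisected homotopy
  spheres (Meier–Schirmer–Zupan 2016 Conj. 3.11 frontier); the route's bet is ROTATION to a non-`S³` base level.

`RankTwo_of : stub₁-sig → stub₂-sig → stub₃-sig → stub₄-sig → RankTwo` is the REAL composition (sorry-free,
standard axioms): normal form; finiteness from `encard ≤ 4`; parity; case `ncard ≤ 2` → rung 1, else `ncard = 4`
(by `omega` from evenness and `≤ 4`) → rung 2. Its hypotheses are the stub statements under the name-keyed aliases
`Registered.stub_*` (device of `Cruxes/RungFour/Lines/birth.lean`: `#h21_check_skeleton` admits hypotheses that are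
declared stubs BY NAME); the closing `example : RankTwo` wires the four sorried stubs into it. `sorry` occurs ONLY in
the four `stub_*` theorems.

Disproof used: none — `ledger crux ls stmt-SmoothPoincare4-6423` showed no workfiles (no `Disproof.lean`, no
`_false_without_` theorem, no `Theorems/RankTwo/Negative/*`) at registration (2026-08-17); negatives index
(`ledger negatives --problem SmoothPoincare4`): 0 refuted statements. Dead lines: none recorded on this crux.
Load-bearing hypotheses honoured: primitivity (without it `stub_noLocalExtrema` is false — a null-homotopic Morse map
has a minimum — and the crux is vacuous-false), the cross-section `∃ e` (kept in both open stubs: it is what makes a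
refutation an exotic `S⁴` rather than an exotic `S¹×S³`), `X ≃ₕ S¹×S³` (parity needs `χ = 0`).
Barriers: PropertyTwoRBarrier / StrictPropertyTwoRBarrier (conditional AC-obstruction to slide-only proofs over the
level `S³`) bite only on a prover who attacks `stub_rungTwoNoExtrema`'s `(0,2,2)` sector by handle slides over `S³`;
the stubs ask for a fibration, not slide-triviality, and leave the base level free. LowGenusTrisectionBarrier marks
`g ≤ 2` as solved; the `(1,2,1)` sector sits at the first open type and the skeleton does not claim it for free.
-/

set_option linter.dupNamespace false

noncomputable section

open scoped Manifold ContDiff Topology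
open Set Filter

namespace Summit.SmoothPoincare4.SmoothPoincare4.Cruxes.RankTwo.Birth

open Summit.SmoothPoincare4.SmoothPoincare4.Theses.CircularKirby (RankTwo)

/-! ## The four registered stubs -/

/-- **Stub 1 — normal form: no local extrema (elimination of index `0` and `4`).**
On a closed smooth 4-manifold `X`, every PRIMITIVE circle-valued Morse map `f : X → S¹` can be replaced by a
primitive circle-valued Morse map `g` with no more critical points (`#Crit g ≤ #Crit f` in `ℕ∞`) and none of
index `0` or `4` (`circleMorseIndex (𝓡 4) g x ∉ {0, 4}` at every critical point `x`, i.e. no local minima / maxima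
of the local heights). Primitivity makes `X` connected and the lift of `f` to the connected infinite cyclic cover
unbounded in both directions, so every local minimum is cancelled against an index-1 critical point joined to it by
a single gradient line (and dually). The printed source proves the sharper `m_i(g) ≤ m_i(f)` for every `i`.
Why plausibly true: it is a theorem (Pajitnov–Rudolph–Weber 2002, Lemma 3.2; Endo–Pajitnov 2017, Prop. 1.3 for
2-knot complements, "proof repeats the proof of Lemma 3.2 in [PRW]"). Size: L (XL formal: Morse cancellation is not
in Mathlib; the real-valued model is Matsumoto 2002, Thm. 3.28 (cancelling a `λ/(λ+1)` pair meeting in one point,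
by a modification supported near the pair) and Thm. 3.35 (a closed connected `m`-manifold has a Morse function with
a single index-`0` and a single index-`m` critical point), held text pp. 114, 119–120).
[cite: PajitnovRudolphWeber2002, Lemma 3.2] [cite: EndoPajitnov2017, Prop. 1.3]
[cite: Matsumoto2002, Thm. 3.28 and Thm. 3.35] [cite: MilnorHCobordism1965, Thm. 5.4 and Thm. 8.1] -/
theorem stub_noLocalExtrema :
    ∀ (X : Type) [TopologicalSpace X] [T2Space X] [SecondCountableTopology X] [CompactSpace X]
      [ChartedSpace (EuclideanSpace ℝ (Fin 4)) X] [IsManifold (𝓡 4) ∞ X]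
      (f : X → Circle), Literature.Topology.FourManifolds.IsCircleMorse (𝓡 4) f →
      Literature.Topology.FourManifolds.IsPrimitive f →
      ∃ g : X → Circle, Literature.Topology.FourManifolds.IsCircleMorse (𝓡 4) g ∧
        Literature.Topology.FourManifolds.IsPrimitive g ∧
        (Literature.Topology.FourManifolds.circleCriticalSet (𝓡 4) g).encard ≤
          (Literature.Topology.FourManifolds.circleCriticalSet (𝓡 4) f).encard ∧
        ∀ x ∈ Literature.Topology.FourManifolds.circleCriticalSet (𝓡 4) g,
          Literature.Topology.FourManifolds.circleMorseIndex (𝓡 4) g x ≠ 0 ∧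
            Literature.Topology.FourManifolds.circleMorseIndex (𝓡 4) g x ≠ 4 := by
  sorry

/-- **Stub 2 — parity of the number of critical points (`χ = 0`).**
On a closed smooth 4-manifold `X` homotopy equivalent to `S¹×S³`, every circle-valued Morse map has an EVEN
number of critical points (the critical set is finite — tree theorem
`IsCircleMorse.finite_circleCriticalSet_holds` — so `ncard` is the honest count). Proof route:
`Σ_k (−1)^k c_k(f) = χ(X)` (Poincaré–Hopf for a gradient-like vector field, the zero at a critical point of index
`k` having index `(−1)^k`; equivalently the Euler characteristic of the Novikov complex), and
`χ(X) = χ(S¹×S³) = 0`; in tree: cut `X` open along a regular level into a cobordism `(W; Y, Y)` and use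
`Cobordism.IsMorseFunction.morseCount_eq_zero_of_relEuler_eq` / `relEuler_empty_eq_of_homotopyEquiv`
(CobordismMorseCountEuler.lean, proved). Why plausibly true: it is a theorem. Size: M on paper, L–XL formal.
[cite: MilnorTFDV1965, §6 (Poincaré–Hopf)] [cite: HirschDT1976, Ch. 6 §3, Thm. 3.5]
[cite: Farber2004, Prop. 1.40] [cite: Pajitnov2006, Novikov inequalities] -/
theorem stub_evenCriticalCount :
    ∀ (X : Type) [TopologicalSpace X] [T2Space X] [SecondCountableTopology X] [CompactSpace X]
      [ChartedSpace (EuclideanSpace ℝ (Fin 4)) X] [IsManifold (𝓡 4) ∞ X],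
      ContinuousMap.HomotopyEquiv X (Circle × (Metric.sphere (0 : EuclideanSpace ℝ (Fin 4)) 1)) →
      ∀ (f : X → Circle), Literature.Topology.FourManifolds.IsCircleMorse (𝓡 4) f →
        Even (Literature.Topology.FourManifolds.circleCriticalSet (𝓡 4) f).ncard := by
  sorry

/-- **Stub 3 — RUNG 1 on the class `𝒳` (the route's crux `RankOne`, item stmt-SmoothPoincare4-6424, specialised).**
For a closed smooth `X ≃ₕ S¹×S³` containing a smoothly embedded non-separating `S³`: a primitive circle-valued
Morse map with at most `2` critical points yields a primitive circle-valued submersion (so `X` fibres over `S¹`).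
Route to it (route header): the indices are `{2, 3}`; levels `Y` and `Y_K ≅ Y # (S¹×S²)` with the 3-handle on a
non-separating sphere `A`; `X̄ ≃ S³` forces the algebraic intersection `d = A·K* ∈ {0, ±1}`, to be upgraded to
geometric intersection (cancel) resp. disjointness (rotate). Follows from `RankOne` (every homotopy `S¹×S³`) by
specialisation; not touched by an exotic `S¹×S³` without cross-section. Why it might fail: `Y_K ≅ Y # S¹×S² ⇒ K
is a local 0-framed unknot` is in print only for `Y = S³, S¹×S²` (Gabai 1987; Gompf–Scharlemann–Thompson 2010
Prop. 3.2). Size: L / open. [cite: GabaiJDG1987, Cor. 8.3] [cite: GompfScharlemannThompson2010, Prop. 3.2]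
[cite: EndoPajitnov2017, §5] -/
theorem stub_rungOne :
    ∀ (X : Type) [TopologicalSpace X] [T2Space X] [SecondCountableTopology X] [CompactSpace X]
      [ChartedSpace (EuclideanSpace ℝ (Fin 4)) X] [IsManifold (𝓡 4) ∞ X],
      ContinuousMap.HomotopyEquiv X (Circle × (Metric.sphere (0 : EuclideanSpace ℝ (Fin 4)) 1)) →
      (∃ e : (Metric.sphere (0 : EuclideanSpace ℝ (Fin 4)) 1) → X,
          Manifold.IsSmoothEmbedding (𝓡 3) (𝓡 4) ∞ e ∧ IsConnected (Set.range e)ᶜ) →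
      ∀ (f : X → Circle), Literature.Topology.FourManifolds.IsCircleMorse (𝓡 4) f →
        Literature.Topology.FourManifolds.IsPrimitive f →
        (Literature.Topology.FourManifolds.circleCriticalSet (𝓡 4) f).encard ≤ 2 →
        ∃ g : X → Circle, ContMDiff (𝓡 4) (𝓡 1) ∞ g ∧
          Literature.Topology.FourManifolds.IsPrimitive g ∧
          ∀ x, ¬ Literature.Topology.FourManifolds.IsCircleCriticalPt (𝓡 4) g x := by
  sorry

/-- **Stub 4 (THE HEART) — RUNG 2 proper: four critical points, no local extrema.**
For a closed smooth `X ≃ₕ S¹×S³` containing a smoothly embedded non-separating `S³`: a primitive circle-valued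
Morse map with EXACTLY `4` critical points, none of index `0` or `4`, yields a primitive circle-valued submersion.
By `−c₁ + c₂ − c₃ = χ(X) = 0` the index pattern is `c₂ = 2`, `(c₁, c₃) ∈ {(0,2), (1,1), (2,0)}` (and `(2,0)` is
`(0,2)` for `f⁻¹`): over an ARBITRARY base level `Y` (rotation), the sector `(0,2,2)` contains weak generalised
Property 2R for 2-component links with surgery `#²(S¹×S²)` and `(1,2,1)` the `(3;1,1,1)`-trisected homotopy
4-spheres. Why plausibly true: SPC4-implied (a refutation inside `𝒳` is an exotic `S⁴` with `μ○ = 4`). Why it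
might fail: it contains GST §9 (open) and MSZ Conj. 3.11's frontier; the bet that rotating to a non-`S³` level
simplifies the attaching knots is untested. Size: open-problem (= the crux's own risk).
[cite: GompfScharlemannThompson2010, §9] [cite: MeierSchirmerZupan2016, Conj. 3.11] [cite: MeierZupan2017]
[cite: Pajitnov2006] -/
theorem stub_rungTwoNoExtrema :
    ∀ (X : Type) [TopologicalSpace X] [T2Space X] [SecondCountableTopology X] [CompactSpace X]
      [ChartedSpace (EuclideanSpace ℝ (Fin 4)) X] [IsManifold (𝓡 4) ∞ X],
      ContinuousMap.HomotopyEquiv X (Circle × (Metric.sphere (0 : EuclideanSpace ℝ (Fin 4)) 1)) →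
      (∃ e : (Metric.sphere (0 : EuclideanSpace ℝ (Fin 4)) 1) → X,
          Manifold.IsSmoothEmbedding (𝓡 3) (𝓡 4) ∞ e ∧ IsConnected (Set.range e)ᶜ) →
      ∀ (f : X → Circle), Literature.Topology.FourManifolds.IsCircleMorse (𝓡 4) f →
        Literature.Topology.FourManifolds.IsPrimitive f →
        (Literature.Topology.FourManifolds.circleCriticalSet (𝓡 4) f).encard = 4 →
        (∀ x ∈ Literature.Topology.FourManifolds.circleCriticalSet (𝓡 4) f,
          Literature.Topology.FourManifolds.circleMorseIndex (𝓡 4) f x ≠ 0 ∧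
            Literature.Topology.FourManifolds.circleMorseIndex (𝓡 4) f x ≠ 4) →
        ∃ g : X → Circle, ContMDiff (𝓡 4) (𝓡 1) ∞ g ∧
          Literature.Topology.FourManifolds.IsPrimitive g ∧
          ∀ x, ¬ Literature.Topology.FourManifolds.IsCircleCriticalPt (𝓡 4) g x := by
  sorry

/-! ## Name-keyed aliases of the four stub statements (hypotheses of the composition) -/
namespace Registered

/-- Alias: the signature of `stub_noLocalExtrema`. -/
abbrev stub_noLocalExtrema : Prop :=
    ∀ (X : Type) [TopologicalSpace X] [T2Space X] [SecondCountableTopology X] [CompactSpace X]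
      [ChartedSpace (EuclideanSpace ℝ (Fin 4)) X] [IsManifold (𝓡 4) ∞ X]
      (f : X → Circle), Literature.Topology.FourManifolds.IsCircleMorse (𝓡 4) f →
      Literature.Topology.FourManifolds.IsPrimitive f →
      ∃ g : X → Circle, Literature.Topology.FourManifolds.IsCircleMorse (𝓡 4) g ∧
        Literature.Topology.FourManifolds.IsPrimitive g ∧
        (Literature.Topology.FourManifolds.circleCriticalSet (𝓡 4) g).encard ≤
          (Literature.Topology.FourManifolds.circleCriticalSet (𝓡 4) f).encard ∧
        ∀ x ∈ Literature.Topology.FourManifolds.circleCriticalSet (𝓡 4) g,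
          Literature.Topology.FourManifolds.circleMorseIndex (𝓡 4) g x ≠ 0 ∧
            Literature.Topology.FourManifolds.circleMorseIndex (𝓡 4) g x ≠ 4

/-- Alias: the signature of `stub_evenCriticalCount`. -/
abbrev stub_evenCriticalCount : Prop :=
    ∀ (X : Type) [TopologicalSpace X] [T2Space X] [SecondCountableTopology X] [CompactSpace X]
      [ChartedSpace (EuclideanSpace ℝ (Fin 4)) X] [IsManifold (𝓡 4) ∞ X],
      ContinuousMap.HomotopyEquiv X (Circle × (Metric.sphere (0 : EuclideanSpace ℝ (Fin 4)) 1)) →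
      ∀ (f : X → Circle), Literature.Topology.FourManifolds.IsCircleMorse (𝓡 4) f →
        Even (Literature.Topology.FourManifolds.circleCriticalSet (𝓡 4) f).ncard

/-- Alias: the signature of `stub_rungOne`. -/
abbrev stub_rungOne : Prop :=
    ∀ (X : Type) [TopologicalSpace X] [T2Space X] [SecondCountableTopology X] [CompactSpace X]
      [ChartedSpace (EuclideanSpace ℝ (Fin 4)) X] [IsManifold (𝓡 4) ∞ X],
      ContinuousMap.HomotopyEquiv X (Circle × (Metric.sphere (0 : EuclideanSpace ℝ (Fin 4)) 1)) →
      (∃ e : (Metric.sphere (0 : EuclideanSpace ℝ (Fin 4)) 1) → X,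
          Manifold.IsSmoothEmbedding (𝓡 3) (𝓡 4) ∞ e ∧ IsConnected (Set.range e)ᶜ) →
      ∀ (f : X → Circle), Literature.Topology.FourManifolds.IsCircleMorse (𝓡 4) f →
        Literature.Topology.FourManifolds.IsPrimitive f →
        (Literature.Topology.FourManifolds.circleCriticalSet (𝓡 4) f).encard ≤ 2 →
        ∃ g : X → Circle, ContMDiff (𝓡 4) (𝓡 1) ∞ g ∧
          Literature.Topology.FourManifolds.IsPrimitive g ∧
          ∀ x, ¬ Literature.Topology.FourManifolds.IsCircleCriticalPt (𝓡 4) g x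

/-- Alias: the signature of `stub_rungTwoNoExtrema`. -/
abbrev stub_rungTwoNoExtrema : Prop :=
    ∀ (X : Type) [TopologicalSpace X] [T2Space X] [SecondCountableTopology X] [CompactSpace X]
      [ChartedSpace (EuclideanSpace ℝ (Fin 4)) X] [IsManifold (𝓡 4) ∞ X],
      ContinuousMap.HomotopyEquiv X (Circle × (Metric.sphere (0 : EuclideanSpace ℝ (Fin 4)) 1)) →
      (∃ e : (Metric.sphere (0 : EuclideanSpace ℝ (Fin 4)) 1) → X,
          Manifold.IsSmoothEmbedding (𝓡 3) (𝓡 4) ∞ e ∧ IsConnected (Set.range e)ᶜ) →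
      ∀ (f : X → Circle), Literature.Topology.FourManifolds.IsCircleMorse (𝓡 4) f →
        Literature.Topology.FourManifolds.IsPrimitive f →
        (Literature.Topology.FourManifolds.circleCriticalSet (𝓡 4) f).encard = 4 →
        (∀ x ∈ Literature.Topology.FourManifolds.circleCriticalSet (𝓡 4) f,
          Literature.Topology.FourManifolds.circleMorseIndex (𝓡 4) f x ≠ 0 ∧
            Literature.Topology.FourManifolds.circleMorseIndex (𝓡 4) f x ≠ 4) →
        ∃ g : X → Circle, ContMDiff (𝓡 4) (𝓡 1) ∞ g ∧
          Literature.Topology.FourManifolds.IsPrimitive g ∧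
          ∀ x, ¬ Literature.Topology.FourManifolds.IsCircleCriticalPt (𝓡 4) g x

end Registered

/-! ## The composition (kernel-checked, sorry-free) -/

/-- **Skeleton theorem — the crux BY NAME from the four stubs.** Given the binders of `RankTwo` (`X`,
`e : X ≃ₕ S¹×S³`, the cross-section, and a primitive circle-valued Morse `f` with `≤ 4` critical points, in the
crux's inline phrasing, which is definitionally `IsCircleMorse ∧ IsPrimitive ∧ encard (circleCriticalSet) ≤ 4`):
put `f` in normal form `g` (no local extrema, no more critical points); the critical set of `g` is finite
(`encard ≤ 4`) and of even size (parity stub), hence of size `≤ 2` — rung 1 — or of size exactly `4` — rung 2.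
The resulting primitive submersion is the crux's conclusion, again by `rfl` on the vocabulary.
[cite: EndoPajitnov2017, Prop. 1.3] [cite: PajitnovRudolphWeber2002, Lemma 3.2] -/
theorem RankTwo_of :
    Registered.stub_noLocalExtrema → Registered.stub_evenCriticalCount →
      Registered.stub_rungOne → Registered.stub_rungTwoNoExtrema → RankTwo := by
  intro hElim hEven hOne hTwo X _ _ _ _ _ _ e hemb hf
  obtain ⟨f, hfs, hprim, hmorse, hcount⟩ := hf
  -- the crux's inline data ARE the Literature notions (definitional unfolding)
  have hM : Literature.Topology.FourManifolds.IsCircleMorse (𝓡 4) f := ⟨hfs, hmorse⟩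
  have hP : Literature.Topology.FourManifolds.IsPrimitive f := hprim
  have hc : (Literature.Topology.FourManifolds.circleCriticalSet (𝓡 4) f).encard ≤ 4 := hcount
  -- normal form: no local extrema, no more critical points
  obtain ⟨g, hgM, hgP, hle, hnoext⟩ := hElim X f hM hP
  set C := Literature.Topology.FourManifolds.circleCriticalSet (𝓡 4) g with hCdef
  have hC4 : C.encard ≤ 4 := hle.trans hc
  have hfin : C.Finite := Set.finite_of_encard_le_coe (k := 4) (by exact_mod_cast hC4)
  have hcast : (C.ncard : ℕ∞) = C.encard := hfin.cast_ncard_eq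
  have hn4 : C.ncard ≤ 4 := by
    have h : (C.ncard : ℕ∞) ≤ (4 : ℕ) := by rw [hcast]; exact_mod_cast hC4
    exact_mod_cast h
  -- parity: the count is even
  have hev : Even C.ncard := hEven X e g hgM
  by_cases h2 : C.ncard ≤ 2
  · -- rung 1: at most two critical points
    have h2' : C.encard ≤ 2 := by
      rw [← hcast]
      exact_mod_cast h2
    obtain ⟨k, hk, hkP, hkreg⟩ := hOne X e hemb g hgM hgP h2'
    exact ⟨k, hk, hkP, hkreg⟩
  · -- rung 2: exactly four critical points (even, `≤ 4`, `> 2`)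
    have h4eq : C.ncard = 4 := by
      obtain ⟨m, hm⟩ := hev
      omega
    have h4e : C.encard = 4 := by
      rw [← hcast, h4eq]
      rfl
    obtain ⟨k, hk, hkP, hkreg⟩ := hTwo X e hemb g hgM hgP h4e hnoext
    exact ⟨k, hk, hkP, hkreg⟩

/-- Wiring check: the four registered stubs feed `RankTwo_of` exactly as stated (aliases = signatures), so the
skeleton is `RankTwo` closed modulo the stubs; sorries enter only through them. -/
example : RankTwo :=
  RankTwo_of stub_noLocalExtrema stub_evenCriticalCount stub_rungOne stub_rungTwoNoExtrema

end Summit.SmoothPoincare4.SmoothPoincare4.Cruxes.RankTwo.Birth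

end
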